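import Summits.BirchSwinnertonDyer.Rank1Residual.Additive.GordRankZeroUpperHalfOfProp414
import Summits.BirchSwinnertonDyer.Rank1Residual.Additive.SemistableTwistTowerThree
import Summits.BirchSwinnertonDyer.Rank1Residual.Additive.BudgetFromSelmerGroup
import HarnessLib

/-!
# X4♯(G-ord) ∩ `I₀*`, rank `0`, surj(p) WITHOUT (ram), `B = 0` rows: the tower road and route 2's END
# of record with Delbourgo 1998 Prop. 4 REPLACED by Greenberg's Prop. 4.14 record + control
# (team n1011, row T-CTL-UP, seat p06 GEN 11, FILE 6 — r2 GEN 42's first-refusal item: the `_of_prop414`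
# twin of `ClassX4Gord.bsdp_three_rankZero_of_katoHalf_of_coeffCert_of_pow_le_card_selmerGroup_of_nonAnomalous`,
# END-level fact list 7 ↦ 6)

HONEST FRAMING (cell `b2b-bsdres-*`, team n1011, verbatim): prove what is provable now; shrink each
hard class to its core with data; no claim beyond stated classes. Research route on
CONSTRUCTION-SHAPED X4 / §I N10–N11; ASSEMBLY theorems only — no definition, no named fact, nothing
booked, no residual-map mark moved, no class closed. X4♯(G-ord) stays CONSTRUCTION-SHAPED; the typed
inputs (`BranchUnitCoeffAt`, the Selmer-count certificate, `CycLowerBoundAt`) stay exactly what they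
were. NOTHING of additive-p4's / p10's / route 2's files is edited (twins). RIDER u-2 (referee-1
R12.1): the Prop. 4.14 record is NEVER instantiated on potentially supersingular rows (O5/O6) —
X4♯(G-ord) (`TypeGOrd`) sits inside its printed scope.

## What

FILE 3b re-derived additive-p2's `ClassX4Gord.…_of_katoComponent` (binder `hram3 : p = 3 → Ram W p`)
with `hDel ↦ (h414, S, hgood, hB)`. additive-p4's V24 file `GordRankZeroKatoComponentTower` /
`SemistableTwistTowerThree` removed `hram3` altogether: at `p = 3` the tower of `E` follows from
surj(3) on (G-ord, `e = 2`) (`ClassX4Gord.towerSurj_of_surj`, lit-kato's proved good-ordinary case of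
Wuthrich's Lemma 20) and is transported to the good ordinary twist. This file twins that road and then
route 2's `p = 3` END of record (`BudgetFromSelmerGroup`, p10/r2: Kato half `hK`, Delbourgo 1998
Prop. 4 `hDel98`, Delbourgo 2002 AT 3 `hDel3`, GZK, modularity ×2, Prop. 4.14 `h414` — SEVEN named
facts, `h414` ALREADY among them):

* `ClassX4Gord.missingUpperBoundAt_rankZero_of_katoComponent_of_towerSurj_of_prop414`
  (`htower : ∀ n, ρ̄_{E,pⁿ}` onto; no (ram)), `…_of_katoComponent_of_surj_of_prop414` (tower from
  surj(p) on `I₀*`), `…_of_surj_of_prop414_of_shaAn_unit`, `…missingInputAt_iff_lower…`,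
  `…_of_surj_of_lower_of_prop414`, and at `p = 3` (defect `2` automatic, `semistabilityIndex_eq_two_of_typeG_three`)
  `ClassX4Gord.bsdp_three_of_katoComponent_of_surj_of_lower_of_prop414`;
* **`ClassX4Gord.bsdp_three_rankZero_of_katoHalf_of_coeffCert_of_pow_le_card_selmerGroup_of_nonAnomalous_of_prop414`**
  — X4♯(G-ord) at `3` ∧ surj(3), `r_an = 0`, non-CM, non-anomalous, `3 ∤ Tam(E)`: `BSD(E,3)` ⟸ ONE
  3-adic unit coefficient at index `b` + `3 ^ b ≤ #Sel⁽³⁾(E/ℚ)`, from the named facts {Kato half `hK`,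
  Delbourgo 2002 AT 3 `hDel3`, GZK, modularity `hmod`/`hmodD`, Prop. 4.14 `h414`} — SIX: binder diff
  against route 2's END of record REMOVED {`hDel98`}, ADDED {`S`, `hgood`, `hB : ¬ 3 ∣ W.tamagawaProduct`}
  (no new named fact: `h414` was already on the END). The lower half is route 2's own chain verbatim
  (`…cycLowerLeadingTermAt_of_katoHalf_of_coeffCert_of_budget_of_mod_four_eq_three` +
  `ClassX4Gord.missingLowerBoundAt_three_rankZero_of_cycLower_of_nonAnomalous`, `hbud` from the Selmer
  count via `budgetLeLambdaAt_of_prop414_of_pow_le_card_selmerGroup`); only the upper half changes road.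

NOT claimed: `B ≥ 1` rows (`437742q1`-type: `hDel98` stays); anything on the anomalous rows. Axioms
standard.

References: [Kato2004Asterisque] Thm. 17.4 (3); [Wuthrich2014] Lemma 20, Cor. 19; [Delbourgo2002]
Thm. (A)/(B) at 3; [GreenbergLNM1716] Prop. 4.14, §4 Thm. 4.1; [Delbourgo1998] Prop. 4 (REPLACED);
[Miller2011LMS] Def. 1.1; cells/n1011/ROUTE-2.md §II.47; cells/n1011/skel/T-CTL-UP.md.
-/

noncomputable section

open scoped Classical MatrixGroups ModularForm NumberField

open CongruenceSubgroup WeierstrassCurve NumberField Literature.NumberTheory.EllipticCurves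
  Literature.NumberTheory.EllipticCurves.ModularForms
  Literature.NumberTheory.EllipticCurves.Rank1Residual
  Literature.NumberTheory.EllipticCurves.Rank1Residual.Typed
  Literature.NumberTheory.EllipticCurves.Delbourgo2002
  Literature.NumberTheory.GaloisRepresentations
  IsDedekindDomain Rat.HeightOneSpectrum
  Summit.BirchSwinnertonDyer.Rank1Residual.Iwasawa
  Summit.BirchSwinnertonDyer.Rank1Residual.AdditivePotMult

namespace Summit.BirchSwinnertonDyer.Rank1Residual.Additive

variable {W : WeierstrassCurve ℚ} [W.IsElliptic] [W.IsGloballyMinimal] {p : ℕ} [hp : Fact p.Prime]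

/-! ### §1 The tower road (no (ram) binder) -/

/-- **X4♯(G-ord) ∩ `I₀*`, `r_an = 0`, TOWER surjectivity of `E`, `p ∤ Tam(E)`: the upper half
`ord_p #Ш(E) ≤ ord_p #Ш_an(E)` with Delbourgo 1998 Prop. 4 REPLACED by Greenberg's Prop. 4.14 record**,
every odd `p` — twin of additive-p4's `ClassX4Gord.missingUpperBoundAt_rankZero_of_katoComponent_of_towerSurj`:
at `p ≠ 3` FILE 3b's `…_of_katoComponent_of_prop414` (vacuous `ram` premise), at `p = 3` the tower of
`E` transported to the good ordinary twist (`GaloisImage.hasSurjectiveModNGaloisRep_pow_iff_of_model_twist`)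
and fed to FILE 3b's `X4RankZeroTwistOdd.padicValNat_shaOrder_le_shaAn_of_prop414`. Socket above `p`
= T-T3B F7; `p ∤ #E(ℚ)_tors` from `Irr`. [cite: Kato2004Asterisque, Thm. 17.4 (3) (p. 273)]
[cite: GreenbergLNM1716, Prop. 4.14] [cite: Miller2011LMS, Def. 1.1] -/
theorem ClassX4Gord.missingUpperBoundAt_rankZero_of_katoComponent_of_towerSurj_of_prop414
    (hK : Kato2004.charIdeal_dvd_padicLFunctionBranch_component_of_surjective)
    (h414 : Greenberg1999.prop414_noFiniteSubmodule_of_not_dvd_torsionOrder)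
    (hGZK : rank_eq_analyticRank_of_analyticRank_le_one) (hmod : hasEntireLFunction_rat)
    (hmodD : nonempty_modularParametrizationData)
    (hX : ClassX4Gord W p) (he : semistabilityIndex W p = 2) (hr : W.analyticRank = 0)
    (htower : ∀ n : ℕ, W.HasSurjectiveModNGaloisRep (p ^ n : ℕ))
    (S : Finset (HeightOneSpectrum (𝓞 ℚ)))
    (hgood : ∀ v ∉ S, (p : 𝓞 ℚ) ∉ v.asIdeal ∧ W.HasGoodReductionAt v) (hB : ¬ p ∣ W.tamagawaProduct) :
    MissingUpperBoundAt W p := by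
  have hsurj : Surj W p := by simpa using htower 1
  by_cases hp3 : p = 3
  · obtain ⟨V, iV, iVm, C, hV, hC⟩ := hX.exists_goodOrd_pStar_twist_model W p he
    haveI : NeZero (V.conductorNorm ℤ) := ⟨(V.conductorNorm_pos_holds).ne'⟩
    obtain ⟨Dm⟩ := hmodD V
    obtain ⟨ϖ', -, hϖ'⟩ := exists_rat_mul_imaginaryPeriodRat_eq_minusPeriod Dm
    have hp4 : p % 4 = 3 := by rw [hp3]
    have hC' : C • V.quadraticTwist (-(p : ℚ)) = W := by
      rw [pStar_eq_of_mod_four p (Or.inr hp4), if_neg (by omega)] at hC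
      exact hC
    have hpne : (-(p : ℚ)) ≠ 0 := neg_ne_zero.mpr (Nat.cast_ne_zero.mpr hp.out.ne_zero)
    have htowerV : ∀ n : ℕ, V.HasSurjectiveModNGaloisRep (p ^ n : ℕ) := fun n ↦
      (GaloisImage.hasSurjectiveModNGaloisRep_pow_iff_of_model_twist V p hpne ⟨C, hC'⟩ n).mp
        (htower n)
    obtain ⟨q, hq, hle⟩ := X4RankZeroTwistOdd.padicValNat_shaOrder_le_shaAn_of_prop414 W p h414 hGZK
      hmod
      (chiBranchLeadingTermOddBigImageAt_of_katoComponent W p hK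
        (padicValRat_j_nonneg_of_typeGOrd W p hX.typeGOrd))
      hp4 hr hX.classX4 S
      (fun κ _ v _ hpv ↦ by
        rw [GoodModelLine.ClassX4Gord.localTowerKerPrimary_zero_eq_bot hX hpv κ]; infer_instance)
      hgood hB V C hC' (Or.inl hV) htowerV Dm.isNewformOf ϖ' hϖ'
    exact ⟨q, hq, hle⟩
  · exact ClassX4Gord.missingUpperBoundAt_rankZero_of_katoComponent_of_prop414 hK h414 hGZK hmod hmodD hX
      he hr hsurj (fun h ↦ absurd h hp3) S hgood hB

/-- **X4♯(G-ord) ∩ `I₀*`, `r_an = 0`, surj(p), `p ∤ Tam(E)`: the upper half from named facts alone at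
EVERY odd `p`, `p = 3` INCLUDED, with NO (ram), NO `j`-witness, NO surj(9), NO Manin hypothesis and
Delbourgo 1998 Prop. 4 REPLACED by Greenberg's Prop. 4.14 record** (the certificate-free tower
`ClassX4Gord.towerSurj_of_surj` fed to §1). [cite: Kato2004Asterisque, Thm. 17.4 (3) (p. 273)]
[cite: Wuthrich2014, Lemma 20 (p. 399)] [cite: GreenbergLNM1716, Prop. 4.14] -/
theorem ClassX4Gord.missingUpperBoundAt_rankZero_of_katoComponent_of_surj_of_prop414
    (hK : Kato2004.charIdeal_dvd_padicLFunctionBranch_component_of_surjective)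
    (h414 : Greenberg1999.prop414_noFiniteSubmodule_of_not_dvd_torsionOrder)
    (hGZK : rank_eq_analyticRank_of_analyticRank_le_one) (hmod : hasEntireLFunction_rat)
    (hmodD : nonempty_modularParametrizationData)
    (hX : ClassX4Gord W p) (he : semistabilityIndex W p = 2) (hr : W.analyticRank = 0)
    (hsurj : Surj W p) (S : Finset (HeightOneSpectrum (𝓞 ℚ)))
    (hgood : ∀ v ∉ S, (p : 𝓞 ℚ) ∉ v.asIdeal ∧ W.HasGoodReductionAt v) (hB : ¬ p ∣ W.tamagawaProduct) :
    MissingUpperBoundAt W p :=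
  ClassX4Gord.missingUpperBoundAt_rankZero_of_katoComponent_of_towerSurj_of_prop414 hK h414 hGZK hmod
    hmodD hX he hr (ClassX4Gord.towerSurj_of_surj hX he hsurj) S hgood hB

/-- **`BSD(E,p)` on X4♯(G-ord) ∩ `I₀*` ∧ `r_an = 0` ∧ surj(p) ∧ `p ∤ Tam(E)` ∧ `p ∤ #Ш_an(E)`**, every
odd `p`, Delbourgo-free fact list. [cite: Kato2004Asterisque, Thm. 17.4 (3) (p. 273)] [cite: GreenbergLNM1716, Prop. 4.14] -/
theorem ClassX4Gord.bsdp_rankZero_of_katoComponent_of_surj_of_prop414_of_shaAn_unit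
    (hK : Kato2004.charIdeal_dvd_padicLFunctionBranch_component_of_surjective)
    (h414 : Greenberg1999.prop414_noFiniteSubmodule_of_not_dvd_torsionOrder)
    (hGZK : rank_eq_analyticRank_of_analyticRank_le_one) (hmod : hasEntireLFunction_rat)
    (hmodD : nonempty_modularParametrizationData)
    (hX : ClassX4Gord W p) (he : semistabilityIndex W p = 2) (hr : W.analyticRank = 0)
    (hsurj : Surj W p) (S : Finset (HeightOneSpectrum (𝓞 ℚ)))
    (hgood : ∀ v ∉ S, (p : 𝓞 ℚ) ∉ v.asIdeal ∧ W.HasGoodReductionAt v) (hB : ¬ p ∣ W.tamagawaProduct)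
    {q : ℚ} (hq : shaAn W = (q : ℂ)) (hv : padicValRat p q = 0) : BSDp W p :=
  bsdp_of_missingPPartAt W p hGZK (by rw [hr]; exact zero_le_one)
    (missingPPartAt_of_upper_of_shaAn_unit W p
      (ClassX4Gord.missingUpperBoundAt_rankZero_of_katoComponent_of_surj_of_prop414 hK h414 hGZK hmod hmodD
        hX he hr hsurj S hgood hB) hq hv)

/-- **X4♯(G-ord) ∩ `I₀*` ∧ `r_an = 0` ∧ surj(p) ∧ `p ∤ Tam(E)`: what remains is EXACTLY the lower
half**, Delbourgo-free fact list. [cite: Kato2004Asterisque, Thm. 17.4 (3) (p. 273)] [cite: GreenbergLNM1716, Prop. 4.14] -/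
theorem ClassX4Gord.missingInputAt_iff_lower_rankZero_of_katoComponent_of_surj_of_prop414
    (hK : Kato2004.charIdeal_dvd_padicLFunctionBranch_component_of_surjective)
    (h414 : Greenberg1999.prop414_noFiniteSubmodule_of_not_dvd_torsionOrder)
    (hGZK : rank_eq_analyticRank_of_analyticRank_le_one) (hmod : hasEntireLFunction_rat)
    (hmodD : nonempty_modularParametrizationData)
    (hX : ClassX4Gord W p) (he : semistabilityIndex W p = 2) (hr : W.analyticRank = 0)
    (hsurj : Surj W p) (S : Finset (HeightOneSpectrum (𝓞 ℚ)))
    (hgood : ∀ v ∉ S, (p : 𝓞 ℚ) ∉ v.asIdeal ∧ W.HasGoodReductionAt v) (hB : ¬ p ∣ W.tamagawaProduct) :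
    X4.MissingInputAt W p ↔ MissingLowerBoundAt W p :=
  ⟨fun h ↦ (lower_and_upper_of_missingPPartAt W p h).1, fun h ↦
    missingPPartAt_of_lower_of_upper W p h
      (ClassX4Gord.missingUpperBoundAt_rankZero_of_katoComponent_of_surj_of_prop414 hK h414 hGZK hmod hmodD
        hX he hr hsurj S hgood hB)⟩

/-- **`BSD(E,p)` on X4♯(G-ord) ∩ `I₀*` ∧ `r_an = 0` ∧ surj(p) ∧ `p ∤ Tam(E)` from the LOWER half**,
every odd `p`, Delbourgo-free fact list. [cite: Kato2004Asterisque, Thm. 17.4 (3) (p. 273)]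
[cite: GreenbergLNM1716, Prop. 4.14] [cite: Miller2011LMS, §1 and Def. 1.1] -/
theorem ClassX4Gord.bsdp_rankZero_of_katoComponent_of_surj_of_lower_of_prop414
    (hK : Kato2004.charIdeal_dvd_padicLFunctionBranch_component_of_surjective)
    (h414 : Greenberg1999.prop414_noFiniteSubmodule_of_not_dvd_torsionOrder)
    (hGZK : rank_eq_analyticRank_of_analyticRank_le_one) (hmod : hasEntireLFunction_rat)
    (hmodD : nonempty_modularParametrizationData)
    (hX : ClassX4Gord W p) (he : semistabilityIndex W p = 2) (hr : W.analyticRank = 0)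
    (hsurj : Surj W p) (S : Finset (HeightOneSpectrum (𝓞 ℚ)))
    (hgood : ∀ v ∉ S, (p : 𝓞 ℚ) ∉ v.asIdeal ∧ W.HasGoodReductionAt v) (hB : ¬ p ∣ W.tamagawaProduct)
    (hlow : MissingLowerBoundAt W p) : BSDp W p :=
  bsdp_of_missingPPartAt W p hGZK (by rw [hr]; exact zero_le_one)
    (missingPPartAt_of_lower_of_upper W p hlow
      (ClassX4Gord.missingUpperBoundAt_rankZero_of_katoComponent_of_surj_of_prop414 hK h414 hGZK hmod hmodD
        hX he hr hsurj S hgood hB))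

/-- **`p = 3`: `BSD(E,3)` on X4♯(G-ord) (`I₀*` automatic at `3`) ∧ `r_an = 0` ∧ surj(3) ∧
`3 ∤ Tam(E)` from the LOWER half**, no certificate, Delbourgo-free fact list — twin of additive-p4's
`ClassX4Gord.bsdp_three_of_katoComponent_of_surj_of_lower`. [cite: Kato2004Asterisque, Thm. 17.4 (3) (p. 273)]
[cite: GreenbergLNM1716, Prop. 4.14] [cite: Miller2011LMS, §1 and Def. 1.1] -/
theorem ClassX4Gord.bsdp_three_of_katoComponent_of_surj_of_lower_of_prop414 [Fact (Nat.Prime 3)]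
    {W : WeierstrassCurve ℚ} [W.IsElliptic] [W.IsGloballyMinimal]
    (hK : Kato2004.charIdeal_dvd_padicLFunctionBranch_component_of_surjective)
    (h414 : Greenberg1999.prop414_noFiniteSubmodule_of_not_dvd_torsionOrder)
    (hGZK : rank_eq_analyticRank_of_analyticRank_le_one) (hmod : hasEntireLFunction_rat)
    (hmodD : nonempty_modularParametrizationData)
    (hX : ClassX4Gord W 3) (hr : W.analyticRank = 0) (hsurj : Surj W 3)
    (S : Finset (HeightOneSpectrum (𝓞 ℚ)))
    (hgood : ∀ v ∉ S, ((3 : ℕ) : 𝓞 ℚ) ∉ v.asIdeal ∧ W.HasGoodReductionAt v) (hB : ¬ 3 ∣ W.tamagawaProduct)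
    (hlow : MissingLowerBoundAt W 3) : BSDp W 3 :=
  ClassX4Gord.bsdp_rankZero_of_katoComponent_of_surj_of_lower_of_prop414 hK h414 hGZK hmod hmodD hX
    (semistabilityIndex_eq_two_of_typeG_three W hX.typeGOrd.typeG hX.addv.2) hr hsurj S hgood hB hlow

/-! ### §2 Route 2's END of record, `hDel98 ↦ ∅` -/

/-- **X4♯(G-ord) at `3` ∧ surj(3), `r_an = 0`, non-CM, non-anomalous, `3 ∤ Tam(E)` (N11 (G-ord) rows,
census status `OPEN:LOWER(pure)`): `BSD(E,3)` ⟸ ONE 3-adic unit coefficient at index `b` +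
`3 ^ b ≤ #Sel⁽³⁾(E/ℚ)`, with Delbourgo 1998 Prop. 4 NOT in the fact list** — the `_of_prop414` twin of
route 2's END of record `ClassX4Gord.bsdp_three_rankZero_of_katoHalf_of_coeffCert_of_pow_le_card_selmerGroup_of_nonAnomalous`
(p10 / r2, `BudgetFromSelmerGroup`). Named facts: Kato half `hK`, Delbourgo 2002 AT 3 `hDel3`, GZK,
modularity `hmod` / `hmodD`, Greenberg Prop. 4.14 `h414` (SIX; the END of record has these six AND
`hDel98`). Lower half = route 2's chain verbatim (`hbud` from the Selmer count through `h414`, the odd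
Λ-adic bridge, `mainTheorem_three` off the anomalous rows); upper half = §1 (tower from surj(3)).
Extra binders: the census place data `S / hgood` and `hB : ¬ 3 ∣ W.tamagawaProduct` (B = 0).
[cite: Kato2004Asterisque, Thm. 17.4 (3) (p. 273)] [cite: Delbourgo2002, Theorem (A), (B) (p. 40), Hypothesis (p. 39)]
[cite: GreenbergLNM1716, Prop. 4.14 (p. 114)] [cite: Miller2011LMS, §1 and Def. 1.1] -/
theorem ClassX4Gord.bsdp_three_rankZero_of_katoHalf_of_coeffCert_of_pow_le_card_selmerGroup_of_nonAnomalous_of_prop414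
    [Fact (Nat.Prime 3)] {W : WeierstrassCurve ℚ} [W.IsElliptic] [W.IsGloballyMinimal]
    (hK : Wuthrich2014.kato_halfEigenCharIdeal_dvd_cyclotomicPrime_of_surjective)
    (hDel3 : Delbourgo2002.mainTheorem_three)
    (hGZK : rank_eq_analyticRank_of_analyticRank_le_one) (hmod : hasEntireLFunction_rat)
    (hmodD : nonempty_modularParametrizationData)
    (h414 : Greenberg1999.prop414_noFiniteSubmodule_of_not_dvd_torsionOrder)
    (hX : ClassX4Gord W 3) (hcm : ¬ W.HasCM) (hsurj : Surj W 3) (hr : W.analyticRank = 0)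
    {b : ℕ} (hcert : BranchUnitCoeffAt W 3 b) (hSel : 3 ^ b ≤ Nat.card (selmerGroup W (3 : ℤ)))
    (hna : ReductionNonAnomalous W 3) (S : Finset (HeightOneSpectrum (𝓞 ℚ)))
    (hgood : ∀ v ∉ S, ((3 : ℕ) : 𝓞 ℚ) ∉ v.asIdeal ∧ W.HasGoodReductionAt v)
    (hB : ¬ 3 ∣ W.tamagawaProduct) : BSDp W 3 :=
  have he : semistabilityIndex W 3 = 2 :=
    semistabilityIndex_eq_two_of_typeG_three W hX.typeGOrd.typeG hX.addv.2
  have hbud : BudgetLeLambdaAt 3 W b :=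
    budgetLeLambdaAt_of_prop414_of_pow_le_card_selmerGroup h414 (not_dvd_torsionOrder_of_surj 3 W hsurj)
      hSel
  ClassX4Gord.bsdp_three_of_katoComponent_of_surj_of_lower_of_prop414
    (Kato2004.charIdeal_dvd_padicLFunctionBranch_component_of_surjective_of_half hK) h414 hGZK hmod hmodD
    hX hr hsurj S hgood hB
    (ClassX4Gord.missingLowerBoundAt_three_rankZero_of_cycLower_of_nonAnomalous hDel3 hGZK hmod hX hcm hr
      hna
      (hX.cycLowerLeadingTermAt_of_katoHalf_of_coeffCert_of_budget_of_mod_four_eq_three hK hmod hmodD he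
        hsurj rfl hcert hbud))

end Summit.BirchSwinnertonDyer.Rank1Residual.Additive

end
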